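import Literature.AlgebraicGeometry.HodgeTheory.SpecialisedHypersurfaceFamilyFunctorial
import Literature.AlgebraicGeometry.HodgeTheory.MonomialSupportedHypersurfaceMonodromy
import Literature.AlgebraicGeometry.HodgeTheory.CyclicCoverScalingFamily
import HarnessLib

/-!
# Linear pencils `f₀ + u·g` of hypersurfaces supported on a set of monomials, as algebraic sub-families of
# the `M`-supported family

Family `hodge`, layer `Literature/AlgebraicGeometry/HodgeTheory`, namespace `…HodgeTheory.MonomialPencil`.
Small definitions (`pencilSpz`, `pencilCoord`, four abbreviations) and proved bookkeeping, no named fact.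
Written by the prover seat `hodge-nonav-prover-Ax` (g15, cell `hodge-nonav`) for route `SignSymmetricPowers` of
the Hodge summit (crux K1-B, stmt-HodgeConjecture-19716), programme PENCIL-B (brick «F-mono»): the companion, for
the family `familyM k n d M : 𝒴_M ⟶ S_M` of smooth hypersurfaces of degree `d` in `ℙⁿ⁺¹` supported on a set `M`
of monomials (`Motives/MonomialSupportedHypersurfaceFamily`), of the file `CyclicCoverLinearPencil` (route
`CyclicUnitaryPowers`).  Sequel: `MonomialSupportedLinearPencilLoops` (Zariski's theorem for these pencils).

KEY REMARK (`baseM_eq_baseSpz`, `rfl`): the `M`-supported family IS the specialised family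
(`Motives/SpecialisedHypersurfaceFamily`) of the surjective specialisation `killHom M : k[a_m] → k[a_m | m ∈ M]`,
so the functoriality `baseSpzMap` (`SpecialisedHypersurfaceFamilyFunctorial`) applies verbatim.

* §1 `pencilSpz f₀ g : ℂ[a_m | m ∈ M] →ₐ ℂ[c]`, `a_m ↦ (f₀)_m + g_m c`; the base
  `pencilBase = baseSpz (pencilSpz ∘ killHom)` — the open set of `u ∈ 𝔸¹` with `Σ_m ((f₀)_m + u g_m) x^m`
  nonsingular — and the morphism `pencilMap : pencilBase ⟶ baseM ℂ n d M`.
* §2 The coordinate `pencilCoord c ∈ ℂ` of a point `c` of the pencil base; the `M`-coefficients of the form of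
  its image are `(f₀)_m + pencilCoord c · g_m` (`coeff_pointFormM_map_pencilMap_of_mem`); every point of `S_M(ℂ)`
  whose form has `M`-coefficients `f₀ + u g` is the image of a point of the pencil with coordinate `u`
  (`exists_pencilCoord_eq_of_coeff`).
* §3 The coordinate is a topological embedding `P(ℂ) ↪ ℂ` (`isEmbedding_pencilCoord`).
* §4 Forms: for `M`-supported forms `F₀, G` of degree `d` with coefficient vectors `f₀, g`, **the form of the
  image point is the member `F₀ + C (pencilCoord c) · G`** (`pointFormM_map_pencilMap`), every `u` with `F₀ + u G`
  nonsingular is a coordinate (`range_pencilCoord`), and `classifyingPoint t₀ (F₀ + u G) = pencilMap c`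
  (`classifyingPoint_eq_map_pencilMap`).

## References

* [VoisinHodgeII2003] C. Voisin, *Hodge Theory and Complex Algebraic Geometry II*, CUP 2003, §6.2.1 (the universal
  hypersurface and its linear sub-systems), §2.1–2.3 (pencils).
* [Hartshorne1977] R. Hartshorne, *Algebraic Geometry*, II §3 (base extension), Ex. 2.18.
* [SerreGAGA1956] J.-P. Serre, GAGA, §2 n°5 (strong topology of points).
-/

noncomputable section

namespace Literature.AlgebraicGeometry.HodgeTheory

open CategoryTheory MvPolynomial _root_.Topology Set
open Literature.AlgebraicGeometry.Motives Literature.AlgebraicGeometry.Motives.UniversalHypersurface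
open Literature.AlgebraicGeometry.Motives.SmoothHypersurface (IsNonsingularForm)
open Literature.AlgebraicGeometry.HodgeTheory.UniversalHypersurface

namespace MonomialPencil

universe u

/-! ### §0 The `M`-supported family is a specialised family -/

section Spz

variable (k : Type u) [Field k] (n d : ℕ) (M : Set (DegIndex n d))

/-- `S_M = S_{killHom M}` (definitional). [cite: VoisinHodgeII2003, §6.2.1] -/
theorem baseM_eq_baseSpz : baseM k n d M = baseSpz k n d (killHom k n d M) := rfl

/-- `S_M ⟶ U` is `S_{killHom M} ⟶ U` (definitional). [cite: Hartshorne1977, II §3 (base extension)] -/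
theorem toBase_eq_toBaseSpz : toBase k n d M = toBaseSpz k n d (killHom k n d M) := rfl

/-- `𝒴_M ⟶ S_M` is the specialised family of `killHom M` (definitional). [cite: VoisinHodgeII2003, §6.2.1] -/
theorem familyM_eq_familySpz : familyM k n d M = familySpz k n d (killHom k n d M) := rfl

/-- The form of a point of `S_M` is its form as a point of `S_{killHom M}` (definitional).
[cite: VoisinHodgeII2003, §6.2.1] -/
theorem pointFormM_eq_pointFormSpz {K : Type u} [Field K] [Algebra k K] (t : AlgPoints (baseM k n d M) K) :
    pointFormM k n d M t = pointFormSpz k n d (killHom k n d M) t := rfl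

end Spz

/-! ### §1 The pencil specialisation and the pencil base -/

section Pencil

variable (n d : ℕ) (M : Set (DegIndex n d)) (f₀ g : M → ℂ)

/-- **The pencil specialisation** `a_m ↦ (f₀)_m + g_m · c` (`m ∈ M`) of the `M`-coefficients along the line
through `f₀` in the direction `g` (`c = X 0` the pencil parameter). [cite: VoisinHodgeII2003, §2.1 (pencils of hypersurfaces)] -/
def pencilSpz : MvPolynomial M ℂ →ₐ[ℂ] MvPolynomial (Fin 1) ℂ :=
  MvPolynomial.aeval fun m => C (f₀ m) + C (g m) * X 0

/-- `pencilSpz` on a coordinate. [cite: VoisinHodgeII2003, §2.1] -/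
@[simp] theorem pencilSpz_X (m : M) : pencilSpz n d M f₀ g (X m) = C (f₀ m) + C (g m) * X 0 :=
  MvPolynomial.aeval_X _ _

/-- Evaluation: `(pencilSpz q)(u) = q(f₀ + u g)`. [cite: VoisinHodgeII2003, §2.1] -/
theorem eval_pencilSpz (q : MvPolynomial M ℂ) (u : ℂ) :
    MvPolynomial.eval (fun _ : Fin 1 => u) (pencilSpz n d M f₀ g q) = MvPolynomial.eval (fun m => f₀ m + u * g m) q := by
  induction q using MvPolynomial.induction_on with
  | C a => simp [pencilSpz]
  | add p q hp hq => simp only [map_add, hp, hq]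
  | mul_X q m hq => simp only [map_mul, hq, pencilSpz_X, map_add, MvPolynomial.eval_C, MvPolynomial.eval_X]; ring

variable {g} in
/-- For `g ≠ 0` the pencil specialisation is surjective (`c = (a_m − (f₀)_m)/g_m` for `g_m ≠ 0`).
[cite: VoisinHodgeII2003, §2.1] -/
theorem pencilSpz_surjective (hg : g ≠ 0) : Function.Surjective (pencilSpz n d M f₀ g) := by
  obtain ⟨m, hm⟩ : ∃ m, g m ≠ 0 := by
    by_contra h; push Not at h; exact hg (funext h)
  intro q
  refine ⟨MvPolynomial.aeval (fun _ : Fin 1 => C (g m)⁻¹ * (X m - C (f₀ m))) q, ?_⟩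
  rw [← AlgHom.comp_apply]
  have hcomp : (pencilSpz n d M f₀ g).comp (MvPolynomial.aeval fun _ : Fin 1 => C (g m)⁻¹ * (X m - C (f₀ m))) =
      AlgHom.id ℂ _ := by
    refine MvPolynomial.algHom_ext fun i => ?_
    fin_cases i
    rw [AlgHom.comp_apply, MvPolynomial.aeval_X, map_mul, map_sub, pencilSpz_X, AlgHom.id_apply,
      MvPolynomial.algHom_C, MvPolynomial.algHom_C]
    change C (g m)⁻¹ * (C (f₀ m) + C (g m) * X 0 - C (f₀ m)) = (X 0 : MvPolynomial (Fin 1) ℂ)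
    rw [add_sub_cancel_left, ← mul_assoc, ← map_mul, inv_mul_cancel₀ hm, map_one, one_mul]
  rw [hcomp, AlgHom.id_apply]

/-- The composite specialisation `φ' = pencilSpz ∘ killHom M : ℂ[a_m] → ℂ[c]` of the pencil
`Σ_{m ∈ M} ((f₀)_m + c g_m) x^m`. [cite: VoisinHodgeII2003, §6.2.1] -/
abbrev pencilCompSpz : CoeffRing ℂ n d →ₐ[ℂ] MvPolynomial (Fin 1) ℂ := (pencilSpz n d M f₀ g).comp (killHom ℂ n d M)

/-- **The base of the pencil**: the open subscheme of `𝔸¹ = Spec ℂ[c]` of parameters `u` with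
`Σ_{m ∈ M} ((f₀)_m + u g_m) x^m` nonsingular. [cite: VoisinHodgeII2003, §6.2.1] -/
abbrev pencilBase : SchemeOver ℂ := baseSpz ℂ n d (pencilCompSpz n d M f₀ g)

/-- **The pencil as a morphism into the base of the `M`-supported family** `ι : pencilBase ⟶ S_M`.
[cite: Hartshorne1977, II §3 (base extension), Ex. 2.18] -/
abbrev pencilMap : pencilBase n d M f₀ g ⟶ baseM ℂ n d M := baseSpzMap ℂ n d (killHom ℂ n d M) (pencilSpz n d M f₀ g)

variable {g} in
/-- The composite specialisation is surjective for `g ≠ 0`. [cite: Hartshorne1977, II Ex. 2.18(c)] -/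
theorem pencilCompSpz_surjective (hg : g ≠ 0) : Function.Surjective (pencilCompSpz n d M f₀ g) :=
  (pencilSpz_surjective n d M f₀ hg).comp (killHom_surjective ℂ n d M)

end Pencil

/-! ### §2 The coordinate of a point of the pencil base and the coefficients of the form of its image -/

section Coordinate

variable (n d : ℕ) (M : Set (DegIndex n d)) (f₀ g : M → ℂ)

/-- **The coordinate `u = ψ_c(c) ∈ ℂ`** of a complex point `c` of the pencil base.
[cite: VoisinHodgeII2003, §6.2.1] -/
def pencilCoord (c : ComplexPoints (pencilBase n d M f₀ g)) : ℂ :=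
  pointAlgHomSpz ℂ n d (pencilCompSpz n d M f₀ g) c (X 0)

/-- The coefficient homomorphism of a point of the pencil base is evaluation at its coordinate.
[cite: VoisinHodgeII2003, §6.2.1] -/
theorem pointAlgHomSpz_eq_aeval (c : ComplexPoints (pencilBase n d M f₀ g)) :
    pointAlgHomSpz ℂ n d (pencilCompSpz n d M f₀ g) c = MvPolynomial.aeval fun _ : Fin 1 => pencilCoord n d M f₀ g c := by
  refine MvPolynomial.algHom_ext fun i => ?_
  fin_cases i
  rw [MvPolynomial.aeval_X]
  rfl

/-- Values of the coefficient homomorphism: `ψ_c(q) = q(pencilCoord c)`. [cite: VoisinHodgeII2003, §6.2.1] -/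
theorem pointAlgHomSpz_apply_eq_eval (c : ComplexPoints (pencilBase n d M f₀ g)) (q : MvPolynomial (Fin 1) ℂ) :
    pointAlgHomSpz ℂ n d (pencilCompSpz n d M f₀ g) c q = MvPolynomial.eval (fun _ : Fin 1 => pencilCoord n d M f₀ g c) q := by
  rw [pointAlgHomSpz_eq_aeval]
  exact congrFun (MvPolynomial.aeval_eq_eval (f := fun _ : Fin 1 => pencilCoord n d M f₀ g c)) q

/-- The coefficient homomorphism of the image point, on the variables of `M`: `ψ_{ι c}(a_m) = (f₀)_m + u g_m`.
[cite: VoisinHodgeII2003, §6.2.1] -/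
theorem pointAlgHomSpz_map_pencilMap_X (c : ComplexPoints (pencilBase n d M f₀ g)) (m : M) :
    pointAlgHomSpz ℂ n d (killHom ℂ n d M) (AlgPoints.map (pencilMap n d M f₀ g) c) (X m) =
      f₀ m + pencilCoord n d M f₀ g c * g m := by
  have h1 := pointAlgHomSpz_map_baseSpzMap ℂ n d (killHom ℂ n d M) (pencilSpz n d M f₀ g) c (X m)
  rw [pencilSpz_X, pointAlgHomSpz_apply_eq_eval] at h1
  refine h1.trans ?_
  simp only [map_add, map_mul, MvPolynomial.eval_C, MvPolynomial.eval_X]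
  ring

/-- **The `M`-coefficients of the form of the image point**: `coeff_m F_{ι c} = (f₀)_m + pencilCoord c · g_m` for
`m ∈ M`. [cite: VoisinHodgeII2003, §6.2.1] -/
theorem coeff_pointFormM_map_pencilMap_of_mem (c : ComplexPoints (pencilBase n d M f₀ g)) {m : DegIndex n d}
    (hm : m ∈ M) :
    coeff m.1 (pointFormM ℂ n d M (AlgPoints.map (pencilMap n d M f₀ g) c)) = f₀ ⟨m, hm⟩ + pencilCoord n d M f₀ g c * g ⟨m, hm⟩ := by
  rw [coeff_pointFormM_of_mem ℂ n d M _ hm]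
  exact pointAlgHomSpz_map_pencilMap_X n d M f₀ g c ⟨m, hm⟩

/-- The coefficients of the form of the image point outside `M` vanish. [cite: VoisinHodgeII2003, §6.2.1] -/
theorem coeff_pointFormM_map_pencilMap_of_not_mem (c : ComplexPoints (pencilBase n d M f₀ g)) {m : DegIndex n d}
    (hm : m ∉ M) :
    coeff m.1 (pointFormM ℂ n d M (AlgPoints.map (pencilMap n d M f₀ g) c)) = 0 :=
  isSupportedOn_pointFormM ℂ n d M _ m hm

/-- The coordinate is injective (a point of `S_{φ'} ⊆ 𝔸¹` is determined by its coefficient homomorphism).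
[cite: VoisinHodgeII2003, §6.2.1] -/
theorem pencilCoord_injective : Function.Injective (pencilCoord n d M f₀ g) := by
  intro c c' h
  apply pointHomSpz_injective ℂ n d (pencilCompSpz n d M f₀ g)
  have h1 := pointAlgHomSpz_eq_aeval n d M f₀ g c
  have h2 := pointAlgHomSpz_eq_aeval n d M f₀ g c'
  rw [h] at h1
  have h3 : pointAlgHomSpz ℂ n d (pencilCompSpz n d M f₀ g) c = pointAlgHomSpz ℂ n d (pencilCompSpz n d M f₀ g) c' :=
    h1.trans h2.symm
  ext1
  refine RingHom.ext fun q => ?_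
  have := congrArg (fun χ : MvPolynomial (Fin 1) ℂ →ₐ[ℂ] ℂ => χ q) h3
  simpa only [pointAlgHomSpz_apply] using this

/-- **A point of `S_M(ℂ)` whose form has `M`-coefficients `f₀ + u g` is the image of a point of the pencil base
with coordinate `u`.** [cite: VoisinHodgeII2003, §6.2.1] -/
theorem exists_pencilCoord_eq_of_coeff (t : ComplexPoints (baseM ℂ n d M)) (u : ℂ)
    (ht : ∀ m : M, coeff m.1.1 (pointFormM ℂ n d M t) = f₀ m + u * g m) :
    ∃ c : ComplexPoints (pencilBase n d M f₀ g), pencilCoord n d M f₀ g c = u ∧ AlgPoints.map (pencilMap n d M f₀ g) c = t := by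
  have hψ : (MvPolynomial.aeval fun _ : Fin 1 => u).comp (pencilCompSpz n d M f₀ g) = coeffHom ℂ n d (pointFormM ℂ n d M t) := by
    refine MvPolynomial.algHom_ext fun m => ?_
    rw [AlgHom.comp_apply, AlgHom.comp_apply, MvPolynomial.aeval_X]
    by_cases hm : m ∈ M
    · rw [killHom_X_of_mem ℂ n d M hm, pencilSpz_X, map_add, map_mul, MvPolynomial.algHom_C, MvPolynomial.algHom_C,
        MvPolynomial.aeval_X, Algebra.algebraMap_self_apply, Algebra.algebraMap_self_apply, ht ⟨m, hm⟩]
      ring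
    · rw [killHom_X_of_not_mem ℂ n d M hm, map_zero, map_zero, isSupportedOn_pointFormM ℂ n d M t m hm]
  let c : ComplexPoints (pencilBase n d M f₀ g) :=
    pointOfFormSpz ℂ n d (pencilCompSpz n d M f₀ g) (isHomogeneous_pointForm ℂ n d _) (isNonsingularForm_pointForm ℂ n d _) hψ
  have hc : pointHomSpz ℂ n d (pencilCompSpz n d M f₀ g) c = CommRingCat.ofHom (MvPolynomial.aeval fun _ : Fin 1 => u).toRingHom :=
    pointHomSpz_pointOfFormSpz ℂ n d _ _ _ hψ
  have hcoord : pencilCoord n d M f₀ g c = u := by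
    rw [pencilCoord, pointAlgHomSpz_apply, hc, CommRingCat.hom_ofHom]
    change (MvPolynomial.aeval fun _ : Fin 1 => u) (X 0 : MvPolynomial (Fin 1) ℂ) = u
    rw [MvPolynomial.aeval_X]
  refine ⟨c, hcoord, ?_⟩
  -- both points of `S_M` have the same image in `U` (same coefficient homomorphism)
  apply map_toBase_injective ℂ n d M
  apply pointHom_injective ℂ n d
  ext1
  refine MvPolynomial.ringHom_ext (fun r => ?_) fun m => ?_
  · have h1 := congrArg (fun χ : ℂ →+* ℂ => χ r)
      (pointHom_comp_algebraMap ℂ n d (AlgPoints.map (toBase ℂ n d M) (AlgPoints.map (pencilMap n d M f₀ g) c)))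
    have h2 := congrArg (fun χ : ℂ →+* ℂ => χ r) (pointHom_comp_algebraMap ℂ n d (AlgPoints.map (toBase ℂ n d M) t))
    simp only [RingHom.comp_apply] at h1 h2
    rw [MvPolynomial.algebraMap_eq] at h1 h2
    exact h1.trans h2.symm
  · rw [← coeff_pointForm, ← coeff_pointForm]
    change coeff m.1 (pointFormM ℂ n d M (AlgPoints.map (pencilMap n d M f₀ g) c)) = coeff m.1 (pointFormM ℂ n d M t)
    by_cases hm : m ∈ M
    · rw [coeff_pointFormM_map_pencilMap_of_mem n d M f₀ g c hm, hcoord, ht ⟨m, hm⟩]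
    · rw [isSupportedOn_pointFormM ℂ n d M _ m hm, isSupportedOn_pointFormM ℂ n d M t m hm]

end Coordinate

/-! ### §3 The coordinate is a topological embedding -/

section Chart

variable (n d : ℕ) (M : Set (DegIndex n d)) (f₀ g : M → ℂ)

/-- The coefficient vector of the form of a point of the pencil is a polynomial function of the coordinate:
`coeffVector [F_c] m = (φ'(a_m))(u)`. [cite: VoisinHodgeII2003, §6.2.1] -/
theorem coeffVector_map_toBaseSpz_pencil (c : ComplexPoints (pencilBase n d M f₀ g)) (m : DegIndex n d) :
    coeffVector ℂ n d (AlgPoints.map (toBaseSpz ℂ n d (pencilCompSpz n d M f₀ g)) c) m =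
      MvPolynomial.eval (fun _ : Fin 1 => pencilCoord n d M f₀ g c) (pencilCompSpz n d M f₀ g (X m)) := by
  rw [coeffVector_apply]
  change coeff m.1 (pointFormSpz ℂ n d (pencilCompSpz n d M f₀ g) c) = _
  rw [coeff_pointFormSpz, ← pointAlgHomSpz_apply, pointAlgHomSpz_apply_eq_eval]

variable {g}

/-- The coefficient `a_m`, `m ∈ M`, of the form of a point of the pencil: `(f₀)_m + u g_m`.
[cite: VoisinHodgeII2003, §6.2.1] -/
theorem coeffVector_map_toBaseSpz_pencil_of_mem (c : ComplexPoints (pencilBase n d M f₀ g)) {m : DegIndex n d}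
    (hm : m ∈ M) :
    coeffVector ℂ n d (AlgPoints.map (toBaseSpz ℂ n d (pencilCompSpz n d M f₀ g)) c) m =
      f₀ ⟨m, hm⟩ + pencilCoord n d M f₀ g c * g ⟨m, hm⟩ := by
  rw [coeffVector_map_toBaseSpz_pencil, AlgHom.comp_apply, killHom_X_of_mem ℂ n d M hm, eval_pencilSpz, MvPolynomial.eval_X]

/-- **The coordinate is continuous** (`g ≠ 0`): it is an affine function of a coefficient of the form, which is
continuous on `U(ℂ)` (`continuous_coeffVector`). [cite: SerreGAGA1956, §2 n°5] -/
theorem continuous_pencilCoord (hg : g ≠ 0) : Continuous (pencilCoord n d M f₀ g) := by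
  obtain ⟨m, hm⟩ : ∃ m, g m ≠ 0 := by
    by_contra h; push Not at h; exact hg (funext h)
  have hcont : Continuous fun c : ComplexPoints (pencilBase n d M f₀ g) =>
      coeffVector ℂ n d (AlgPoints.map (toBaseSpz ℂ n d (pencilCompSpz n d M f₀ g)) c) m.1 :=
    (continuous_apply m.1).comp ((continuous_coeffVector ℂ n d).comp (AlgPoints.continuous_map _))
  have heq : (pencilCoord n d M f₀ g) = fun c =>
      (coeffVector ℂ n d (AlgPoints.map (toBaseSpz ℂ n d (pencilCompSpz n d M f₀ g)) c) m.1 - f₀ m) / g m := by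
    funext c
    rw [coeffVector_map_toBaseSpz_pencil_of_mem n d M f₀ c m.2, add_sub_cancel_left, mul_div_cancel_right₀ _ hm]
  rw [heq]
  exact ((hcont.sub continuous_const).div_const _)

/-- **The coordinate is a topological embedding `P(ℂ) ↪ ℂ`** (`g ≠ 0`): the coefficient vector of the image in
`U(ℂ)`, an embedding (`isEmbedding_map_toBaseSpz`, `isEmbedding_coeffVector`), is a continuous function of the
coordinate. [cite: SerreGAGA1956, §2 n°5] -/
theorem isEmbedding_pencilCoord (hg : g ≠ 0) : IsEmbedding (pencilCoord n d M f₀ g) := by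
  let A : ℂ → (DegIndex n d → ℂ) := fun u m => MvPolynomial.eval (fun _ : Fin 1 => u) (pencilCompSpz n d M f₀ g (X m))
  have hA : Continuous A :=
    continuous_pi fun m => (MvPolynomial.continuous_eval _).comp (continuous_pi fun _ => continuous_id)
  have hE : IsEmbedding fun c : ComplexPoints (pencilBase n d M f₀ g) =>
      coeffVector ℂ n d (AlgPoints.map (toBaseSpz ℂ n d (pencilCompSpz n d M f₀ g)) c) :=
    (isEmbedding_coeffVector ℂ n d).comp
      (CyclicCoverScaling.isEmbedding_map_toBaseSpz (pencilCompSpz n d M f₀ g) (pencilCompSpz_surjective n d M f₀ hg))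
  have hcomp : (fun c : ComplexPoints (pencilBase n d M f₀ g) =>
      coeffVector ℂ n d (AlgPoints.map (toBaseSpz ℂ n d (pencilCompSpz n d M f₀ g)) c)) = A ∘ pencilCoord n d M f₀ g := by
    funext c; funext m
    exact coeffVector_map_toBaseSpz_pencil n d M f₀ g c m
  rw [hcomp] at hE
  exact ⟨IsInducing.of_comp (continuous_pencilCoord n d M f₀ hg) hA hE.isInducing, pencilCoord_injective n d M f₀ g⟩

end Chart

/-! ### §4 The forms of the pencil -/

section Forms

variable (n d : ℕ) (M : Set (DegIndex n d)) {F₀ G : MvPolynomial (Fin (n + 2)) ℂ}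

/-- The `M`-coefficient vector `(coeff_m F)_{m ∈ M}` of a form. [cite: VoisinHodgeII2003, §6.2.1] -/
abbrev coeffsM (F : MvPolynomial (Fin (n + 2)) ℂ) : M → ℂ := fun m => coeff m.1.1 F

/-- `F₀ + u·G` is homogeneous of degree `d` for homogeneous `F₀, G` (the members of a pencil of degree-`d` forms).
[cite: VoisinHodgeII2003, §2.1 (pencils of hypersurfaces)] -/
theorem isHomogeneous_add_C_mul (hF₀ : F₀.IsHomogeneous d) (hG : G.IsHomogeneous d) (u : ℂ) :
    (F₀ + C u * G).IsHomogeneous d := by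
  have h1 : (C u * G).IsHomogeneous (0 + d) := (MvPolynomial.isHomogeneous_C _ u).mul hG
  rw [zero_add] at h1
  exact hF₀.add h1

/-- The coefficients of the member `F₀ + u·G` of a pencil. [cite: VoisinHodgeII2003, §2.1 (pencils of hypersurfaces)] -/
theorem coeff_add_C_mul (u : ℂ) (e : Fin (n + 2) →₀ ℕ) : coeff e (F₀ + C u * G) = coeff e F₀ + u * coeff e G := by
  rw [coeff_add, coeff_C_mul]

/-- `F₀ + u·G` is supported on `M` if `F₀` and `G` are. [cite: VoisinHodgeII2003, §6.2.1] -/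
theorem isSupportedOn_add_C_mul (hMF : IsSupportedOn n d M F₀) (hMG : IsSupportedOn n d M G) (u : ℂ) :
    IsSupportedOn n d M (F₀ + C u * G) := fun m hm => by
  rw [coeff_add_C_mul, hMF m hm, hMG m hm, mul_zero, add_zero]

/-- A form supported on `M`, homogeneous of degree `d`, whose `M`-coefficients are those of `F₀ + u·G` IS `F₀ + u·G`.
[cite: VoisinHodgeII2003, §6.2.1] -/
theorem eq_add_C_mul_of_coeff (hF₀ : F₀.IsHomogeneous d) (hG : G.IsHomogeneous d) (hMF : IsSupportedOn n d M F₀)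
    (hMG : IsSupportedOn n d M G) {F : MvPolynomial (Fin (n + 2)) ℂ} (hF : F.IsHomogeneous d) (hM : IsSupportedOn n d M F)
    {u : ℂ} (hc : ∀ m : M, coeff m.1.1 F = coeff m.1.1 F₀ + u * coeff m.1.1 G) : F = F₀ + C u * G := by
  refine MvPolynomial.ext _ _ fun e => ?_
  by_cases he : e.degree = d
  · rw [coeff_add_C_mul]
    by_cases hm : (⟨e, he⟩ : DegIndex n d) ∈ M
    · exact hc ⟨⟨e, he⟩, hm⟩
    · rw [hM ⟨e, he⟩ hm, hMF ⟨e, he⟩ hm, hMG ⟨e, he⟩ hm, mul_zero, add_zero]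
  · rw [hF.coeff_eq_zero he, (isHomogeneous_add_C_mul n d hF₀ hG _).coeff_eq_zero he]

variable (hF₀ : F₀.IsHomogeneous d) (hG : G.IsHomogeneous d) (hMF : IsSupportedOn n d M F₀) (hMG : IsSupportedOn n d M G)
include hF₀ hG hMF hMG

/-- **The form of the image of a point of the pencil is the member `F₀ + u·G`, `u = pencilCoord c`.**
[cite: VoisinHodgeII2003, §6.2.1] -/
theorem pointFormM_map_pencilMap (c : ComplexPoints (pencilBase n d M (coeffsM n d M F₀) (coeffsM n d M G))) :
    pointFormM ℂ n d M (AlgPoints.map (pencilMap n d M (coeffsM n d M F₀) (coeffsM n d M G)) c) =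
      F₀ + C (pencilCoord n d M (coeffsM n d M F₀) (coeffsM n d M G) c) * G :=
  eq_add_C_mul_of_coeff n d M hF₀ hG hMF hMG (isHomogeneous_pointForm ℂ n d _) (isSupportedOn_pointFormM ℂ n d M _)
    fun m => coeff_pointFormM_map_pencilMap_of_mem n d M _ _ c m.2

/-- **Points of the pencil base have nonsingular forms**: `F₀ + u·G` is nonsingular for `u = pencilCoord c`.
[cite: VoisinHodgeII2003, §6.2.1] -/
theorem isNonsingularForm_pencilCoord (c : ComplexPoints (pencilBase n d M (coeffsM n d M F₀) (coeffsM n d M G))) :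
    IsNonsingularForm ℂ (F₀ + C (pencilCoord n d M (coeffsM n d M F₀) (coeffsM n d M G) c) * G) := by
  rw [← pointFormM_map_pencilMap n d M hF₀ hG hMF hMG c]
  exact isNonsingularForm_pointForm ℂ n d _

/-- **Every parameter `u` with `F₀ + u·G` nonsingular is the coordinate of a point of the pencil base**, namely of
a point over `[F₀ + u·G] ∈ S_M(ℂ)`. [cite: VoisinHodgeII2003, §6.2.1] -/
theorem exists_pencilCoord_eq {u : ℂ} (hu : IsNonsingularForm ℂ (F₀ + C u * G)) :
    ∃ c : ComplexPoints (pencilBase n d M (coeffsM n d M F₀) (coeffsM n d M G)),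
      pencilCoord n d M (coeffsM n d M F₀) (coeffsM n d M G) c = u ∧
        AlgPoints.map (pencilMap n d M (coeffsM n d M F₀) (coeffsM n d M G)) c =
          pointOfFormM ℂ n d M (isHomogeneous_add_C_mul n d hF₀ hG u) hu (isSupportedOn_add_C_mul n d M hMF hMG u) :=
  exists_pencilCoord_eq_of_coeff n d M _ _ _ u fun m => by
    rw [pointFormM_pointOfFormM, coeff_add_C_mul]

/-- **The image of the coordinate**: exactly the parameters `u` with `F₀ + u·G` nonsingular.
[cite: VoisinHodgeII2003, §6.2.1 (`B` the open set of nonsingular members)] -/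
theorem range_pencilCoord :
    Set.range (pencilCoord n d M (coeffsM n d M F₀) (coeffsM n d M G)) = {u | IsNonsingularForm ℂ (F₀ + C u * G)} := by
  ext u
  constructor
  · rintro ⟨c, rfl⟩
    exact isNonsingularForm_pencilCoord n d M hF₀ hG hMF hMG c
  · intro hu
    obtain ⟨c, hc, -⟩ := exists_pencilCoord_eq n d M hF₀ hG hMF hMG hu
    exact ⟨c, hc⟩

/-- The point of the pencil with coordinate `u` classifies the member `F₀ + u·G`:
`classifyingPoint t₀ (F₀ + u·G) = pencilMap c`. [cite: VoisinHodgeII2003, §6.2.1] -/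
theorem classifyingPoint_eq_map_pencilMap (t₀ : ComplexPoints (baseM ℂ n d M))
    (c : ComplexPoints (pencilBase n d M (coeffsM n d M F₀) (coeffsM n d M G))) :
    classifyingPoint ℂ n d M t₀ (F₀ + C (pencilCoord n d M (coeffsM n d M F₀) (coeffsM n d M G) c) * G) =
      AlgPoints.map (pencilMap n d M (coeffsM n d M F₀) (coeffsM n d M G)) c := by
  rw [← pointFormM_map_pencilMap n d M hF₀ hG hMF hMG c]
  exact classifyingPoint_pointFormM ℂ n d M t₀ _

end Forms

end MonomialPencil

end Literature.AlgebraicGeometry.HodgeTheory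

end
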